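import Literature.NumberTheory.Automorphic.Liu2021.LemD1Item3AtVNonsplitMuOfFacts
import Summits.HodgeConjecture.CorCM.B01.Transposition.Item6OmegaChiSplitting
import Summits.HodgeConjecture.HodgeCM.CM.Basic
import Summits.HodgeConjecture.HodgeCM.Model.ArchSideTerm
import Literature.NumberTheory.Automorphic.IdeleClassCharacterHecke
import Literature.RepresentationTheory.Liu2021.OscillatorConventions
import Literature.NumberTheory.GelbartRogawski1991.CMSplittingCharLocalMu
import HarnessLib

/-!
# `hD3` line `a4-liuD3`, stub (:190) `stub_mu_of_iso_nonsplit : MuOfIsoNonsplit` — CLOSED MODULO THE FACTS IV-4c1, IV-4c3 AND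
# KUDLA'S LOCAL INJECTIVITY (transported form), BY NAME (cell `hodgecm-mathlib`, binder `HypD3`; crux item stmt-HodgeConjecture-24837)

Summits side, binder subdirectory `CorCM/HypD3/`.  The crux skeleton `A-plan/lines/a4-liuD3.lean` (v1 sha16 5422b04d6cb4d0fa; v2 =
`e ↦ e₁` + fact binders, RULINGS 02:54:52Z / 02:58:23Z; stub types `Summits/HodgeConjecture/CorCM/HypD3/A4LiuD3Items.lean`) cuts
`hD3` = [Liu2021, Lem. D.1 (3)] AS PRINTED per finite place into five stubs over
`famAtV F e dV hdV hdV0 ψ hψ aOf χOf v := Def411WeilCarriers.localIndexedFamilyAtV F⁺ F c 3 e (diagonal dV) … v`.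
Stub (:190) `MuOfIsoNonsplit` is the `μ`-clause at a place `v` of `F⁺` NON-SPLIT in `F` (`IsField (F ⊗ F⁺_v)`):
«`rankOne_theta_lines_disjoint → rankOne_theta_twist_rigidity → ∀ F dV … v, IsField (F ⊗ F⁺_v) → ∀ i j,
ω(μ_j, ε_j, χ_j)_v ≅ ω(μ_i, ε_i, χ_i)_v → μ_{j,v} = μ_{i,v}`».

This file proves it AT `e₁ = Equiv.prodUnique (Fin 3) (Fin 1)` with `famAtV` replaced by its definiens, GIVEN BY NAME the interface
facts IV-4c1 `rankOne_theta_lines_disjoint` (`h41`) and IV-4c3 `rankOne_theta_twist_rigidity` (`h43`), and — as an explicit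
hypothesis `hK` in the statement (the SAME text as in the split twin `splitInjective_of_facts`, so that ONE discharge serves both),
until the kernel proof of the transported Kudla injectivity (S6a `LocalKudlaSplittingRigidity` / `LocalLineIsometryDoubled` +
S6b `LocalKudlaSplittingInjective.localMu_eq_of_localSplittingCM_eq` + S6c `LocalSplittingCMLocality`) lands — KUDLA'S LOCAL
INJECTIVITY in transported form: if member `i`'s transported section (`lineTransportSection … (aOf i) …`), line-transported onto
member `j`'s line, equals member `j`'s, then `localMu μ_j v = localMu μ_i v`.
Proof = `Def411WeilCarriers.mu_eq_of_areIsomorphicRep_nonsplit_of_facts` (`LemD1Item3AtVNonsplitMuOfFacts.lean`: `quot j ≅ quot i`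
⇒ `δ`-model lifts isomorphic (`areIsomorphicRep_theta_comp_uEquiv_quot`) ⇒ common `ε`-class by IV-4c1 and line transport
(`RankOneThetaLiftLinesEquivalent`) ⇒ equal transported splittings by IV-4c3 (`RankOneThetaLiftNonsplitSeparation`) ⇒ `hK`;
the non-vanishing input is discharged there by `mvw_IV2_rankOne_nonvanishing_of_isotropic_holds`, `V` being isotropic at `v` since
`3 ≤ dim V`).  With v2's fact binders the A-side stub closes by
`fun h41 h43 F dV hdV hdV0 ψ hψ aOf χOf v hE i j hiso => HypD3.muOfIsoNonsplit_of_facts h41 h43 F dV hdV hdV0 ψ hψ aOf χOf v hK hE i j hiso`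
(`famAtV` unfolds by `δ`-reduction) once `hK` is supplied.

HC_CM is proved only modulo the 7 printed citations (`hDel`, `h21`, `hLiu418`, `h411`, `h413`, `hD3`, `hD1''`) until rung 0 closes;
this file discharges no binder and no interface fact (it CONSUMES two by name and one analytic input as a hypothesis).

## References
* [Liu2021] Y. Liu, Camb. J. Math. 9 (2021) = arXiv:2102.11518, App. D Lemma D.1 (3) (l. 5233); proof, non-split case (l. 5255).
* [MoeglinVignerasWaldspurger1987] MVW, LNM 1291, Chap. 3 IV.4 (theta dichotomy for `U(1) × U(3)`).
* [Kudla1994] S. Kudla, Israel J. Math. 87 (1994) — splitting characters of the metaplectic cover over unitary groups.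
-/

set_option autoImplicit false

noncomputable section

namespace Summit.HodgeConjecture.CorCM.HypD3
open scoped TensorProduct Matrix
open NumberField NumberField.InfinitePlace
open Literature.NumberTheory.ComplexMultiplication
open Literature.NumberTheory.Automorphic
open Literature.NumberTheory.Automorphic.IdeleClassGroup (toHeckeCharacter isUnitary_toHeckeCharacter)
open Literature.NumberTheory.Automorphic.Liu2021
open HodgeCM.Model.ArchSideTerm (e₁)
open Literature.NumberTheory.GelbartRogawski1991 Literature.NumberTheory.GelbartRogawski1991.UnitaryDualPair
open Literature.NumberTheory.GelbartRogawski1991.UnitaryDualPair.LocalSplitting (localMu norm_localMu continuous_localMu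
  localMu_toLocalRing_eq_one_iff lineTransportSection conj_lineDelta lineDelta_ne_zero lineDelta_mul_self)
open Literature.RepresentationTheory Literature.RepresentationTheory.Liu2021
open Literature.RepresentationTheory.MoeglinVignerasWaldspurger1987 (rankOne_theta_lines_disjoint rankOne_theta_twist_rigidity
  lineTransportSplitting)
open Summit.HodgeConjecture.CorCM.Transposition

-- heartbeats: elaborating the spelled `hK` binder alone exceeds the default budget (whnf/isDefEq on the packaged CM sections), as in
-- the split twin `A4LiuD3SplitInjectiveOfFacts.lean`; the proof term itself is a single `exact`.
set_option maxHeartbeats 1600000 in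
/-- **Line `a4-liuD3`, stub (:190) `MuOfIsoNonsplit`, PROVED MODULO THE FACTS** IV-4c1 (`h41`), IV-4c3 (`h43`) by name and Kudla's
local injectivity in transported form (`hK`, explicit — the same text as in `splitInjective_of_facts`): for every CM field `F`, real
frame `dV`, index maps `ψ, hψ, aOf, χOf` and finite place `v` of `F⁺` with `F ⊗ F⁺_v` a field, and all members `i, j` of the family
of record at `e₁`: `AreIsomorphicRep (quot j) (quot i) → mu j = mu i`.  Statement = the body of
`Summit.HodgeConjecture.CorCM.Lines.A4LiuD3.MuOfIsoNonsplit` after its two fact binders, at `e := e₁` with `famAtV` unfolded to its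
definiens and the binder `hK` inserted after `v`; proof = `Def411WeilCarriers.mu_eq_of_areIsomorphicRep_nonsplit_of_facts` at the
face family.
[cite: Liu2021, App. D Lemma D.1 (3) (l. 5233), proof l. 5255] [cite: MoeglinVignerasWaldspurger1987, Chap. 3 IV.4] -/
theorem muOfIsoNonsplit_of_facts (h41 : rankOne_theta_lines_disjoint) (h43 : rankOne_theta_twist_rigidity) :
    ∀ (F : HodgeCM.CMField) (dV : Fin 3 → (F : Type))
      (hdV : ∀ i, IsCMField.complexConj (F : Type) (dV i) = dV i) (hdV0 : ∀ i, dV i ≠ 0) {ι : Type}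
      (ψ : ι → (Literature.NumberTheory.Automorphic.IdeleClassGroup (F : Type) →ₜ* Circle))
      (hψ : ∀ t, IdeleClassGroup.IsConjugateSymplectic (F : Type) (ψ t))
      (aOf : ι → (↥(maximalRealSubfield (F : Type)))ˣ)
      (χOf : ι → Def411WeilCarriers.Chi ↥(maximalRealSubfield (F : Type)) (F : Type) (IsCMField.complexConj (F : Type)))
      (v : IsDedekindDomain.HeightOneSpectrum (𝓞 ↥(maximalRealSubfield (F : Type)))),
      (∀ i j : ι,
        (∃ (x : (UnitaryGroup.LocalRing (F : Type) v)ˣ) (hx : algebraMap (F : Type) (UnitaryGroup.LocalRing (F : Type) v) (algebraMap ↥(maximalRealSubfield (F : Type)) (F : Type) (↑(aOf j)⁻¹ : ↥(maximalRealSubfield (F : Type))) * imagUnit (F : Type)) =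
            (x : (UnitaryGroup.LocalRing (F : Type) v)) * UnitaryGroup.conjLocal (F : Type) (IsCMField.complexConj (F : Type)) v x * algebraMap (F : Type) (UnitaryGroup.LocalRing (F : Type) v) (algebraMap ↥(maximalRealSubfield (F : Type)) (F : Type) (↑(aOf i)⁻¹ : ↥(maximalRealSubfield (F : Type))) * imagUnit (F : Type))),
          lineTransportSplitting (F : Type) v (IsCMField.complexConj (F : Type)) 3 (conj_lineDelta (complexConj_imagUnit (F : Type)) (aOf i)) (lineDelta_ne_zero (imagUnit_ne_zero (F : Type)) (aOf i))
            (lineDelta_mul_self (imagUnit_mul_self (F : Type)) (aOf i)) (conj_lineDelta (complexConj_imagUnit (F : Type)) (aOf j)) (lineDelta_ne_zero (imagUnit_ne_zero (F : Type)) (aOf j))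
            (lineDelta_mul_self (imagUnit_mul_self (F : Type)) (aOf j)) x (realDiagonal (F : Type) dV hdV) (realDiagonal_isSymm (F : Type) dV hdV) (isUnit_det_realDiagonal (F : Type) dV hdV hdV0) hx
            (lineTransportSection ↥(maximalRealSubfield (F : Type)) (F : Type) (IsCMField.complexConj (F : Type)) 3 (complexConj_imagUnit (F : Type)) (imagUnit_ne_zero (F : Type)) (imagUnit_mul_self (F : Type)) (realDiagonal (F : Type) dV hdV) (realDiagonal_isSymm (F : Type) dV hdV) (Matrix.diagonal dV) (realDiagonal_map (F : Type) dV hdV).symm (aOf i) v ((OmegaChiSplitting.chiLocalSplittingsD ⟨HodgeCM.CMField.K F⟩ e₁ dV hdV hdV0 (toHeckeCharacter (F : Type) (ψ i)) ((isOscillatorChar_toHeckeCharacter_iff (ψ i)).mpr (hψ i)) (aOf i)).s v) ((OmegaChiSplitting.chiLocalSplittingsD ⟨HodgeCM.CMField.K F⟩ e₁ dV hdV hdV0 (toHeckeCharacter (F : Type) (ψ i)) ((isOscillatorChar_toHeckeCharacter_iff (ψ i)).mpr (hψ i)) (aOf i)).proj_s v)) =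
          (lineTransportSection ↥(maximalRealSubfield (F : Type)) (F : Type) (IsCMField.complexConj (F : Type)) 3 (complexConj_imagUnit (F : Type)) (imagUnit_ne_zero (F : Type)) (imagUnit_mul_self (F : Type)) (realDiagonal (F : Type) dV hdV) (realDiagonal_isSymm (F : Type) dV hdV) (Matrix.diagonal dV) (realDiagonal_map (F : Type) dV hdV).symm (aOf j) v ((OmegaChiSplitting.chiLocalSplittingsD ⟨HodgeCM.CMField.K F⟩ e₁ dV hdV hdV0 (toHeckeCharacter (F : Type) (ψ j)) ((isOscillatorChar_toHeckeCharacter_iff (ψ j)).mpr (hψ j)) (aOf j)).s v) ((OmegaChiSplitting.chiLocalSplittingsD ⟨HodgeCM.CMField.K F⟩ e₁ dV hdV hdV0 (toHeckeCharacter (F : Type) (ψ j)) ((isOscillatorChar_toHeckeCharacter_iff (ψ j)).mpr (hψ j)) (aOf j)).proj_s v))) →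
        localMu (F : Type) (toHeckeCharacter (F : Type) (ψ j)) v = localMu (F : Type) (toHeckeCharacter (F : Type) (ψ i)) v) →
      IsField (UnitaryGroup.LocalRing (F : Type) v) →
      ∀ i j : ι,
        AreIsomorphicRep ((Def411WeilCarriers.localIndexedFamilyAtV (ι := ι) ↥(maximalRealSubfield (F : Type)) (F : Type) (IsCMField.complexConj (F : Type)) 3 e₁ (Matrix.diagonal dV) (complexConj_imagUnit (F : Type)) (imagUnit_ne_zero (F : Type)) (imagUnit_mul_self (F : Type)) (realDiagonal_isSymm (F : Type) dV hdV) (isUnit_det_realDiagonal (F : Type) dV hdV hdV0) (realDiagonal_map (F : Type) dV hdV).symm (le_refl 3) aOf χOf (fun t => OmegaChiSplitting.chiLocalSplittingsD ⟨HodgeCM.CMField.K F⟩ e₁ dV hdV hdV0 (toHeckeCharacter (F : Type) (ψ t)) ((isOscillatorChar_toHeckeCharacter_iff (ψ t)).mpr (hψ t)) (aOf t)) (fun t => localMu (F : Type) (toHeckeCharacter (F : Type) (ψ t))) (fun t v x => norm_localMu (F : Type) (toHeckeCharacter (F : Type) (ψ t)) v (isUnitary_toHeckeCharacter (F : Type)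 (ψ t)) x) (fun t => continuous_localMu (F : Type) (toHeckeCharacter (F : Type) (ψ t))) (fun t v x => localMu_toLocalRing_eq_one_iff (F : Type) (toHeckeCharacter (F : Type) (ψ t)) v ((isOscillatorChar_toHeckeCharacter_iff (ψ t)).mpr (hψ t)) x) v).quot j) ((Def411WeilCarriers.localIndexedFamilyAtV (ι := ι) ↥(maximalRealSubfield (F : Type)) (F : Type) (IsCMField.complexConj (F : Type)) 3 e₁ (Matrix.diagonal dV) (complexConj_imagUnit (F : Type)) (imagUnit_ne_zero (F : Type)) (imagUnit_mul_self (F : Type)) (realDiagonal_isSymm (F : Type) dV hdV) (isUnit_det_realDiagonal (F : Type) dV hdV hdV0) (realDiagonal_map (F : Type) dV hdV).symm (le_refl 3) aOf χOf (fun t => OmegaChiSplitting.chiLocalSplittingsD ⟨HodgeCM.CMField.K F⟩ e₁ dV hdV hdV0 (toHeckeCharacter (F : Type) (ψ t)) ((isOscillatorChar_toHeckeCharacter_iff (ψ t)).mpr (hψ t)) (aOf t)) (fun t => localMu (F : Type) (toHeckeCharacter (F : Type) (ψ t))) (fun t v x => norm_localMu (F : Type) (toHeckeCharacter (F : Type)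 (ψ t)) v (isUnitary_toHeckeCharacter (F : Type) (ψ t)) x) (fun t => continuous_localMu (F : Type) (toHeckeCharacter (F : Type) (ψ t))) (fun t v x => localMu_toLocalRing_eq_one_iff (F : Type) (toHeckeCharacter (F : Type) (ψ t)) v ((isOscillatorChar_toHeckeCharacter_iff (ψ t)).mpr (hψ t)) x) v).quot i) →
        (Def411WeilCarriers.localIndexedFamilyAtV (ι := ι) ↥(maximalRealSubfield (F : Type)) (F : Type) (IsCMField.complexConj (F : Type)) 3 e₁ (Matrix.diagonal dV) (complexConj_imagUnit (F : Type)) (imagUnit_ne_zero (F : Type)) (imagUnit_mul_self (F : Type)) (realDiagonal_isSymm (F : Type) dV hdV) (isUnit_det_realDiagonal (F : Type) dV hdV hdV0) (realDiagonal_map (F : Type) dV hdV).symm (le_refl 3) aOf χOf (fun t => OmegaChiSplitting.chiLocalSplittingsD ⟨HodgeCM.CMField.K F⟩ e₁ dV hdV hdV0 (toHeckeCharacter (F : Type) (ψ t)) ((isOscillatorChar_toHeckeCharacter_iff (ψ t)).mpr (hψ t)) (aOf t)) (fun t => localMu (F : Type) (toHeckeCharacter (F : Type) (ψ t))) (fun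 t v x => norm_localMu (F : Type) (toHeckeCharacter (F : Type) (ψ t)) v (isUnitary_toHeckeCharacter (F : Type) (ψ t)) x) (fun t => continuous_localMu (F : Type) (toHeckeCharacter (F : Type) (ψ t))) (fun t v x => localMu_toLocalRing_eq_one_iff (F : Type) (toHeckeCharacter (F : Type) (ψ t)) v ((isOscillatorChar_toHeckeCharacter_iff (ψ t)).mpr (hψ t)) x) v).mu j = (Def411WeilCarriers.localIndexedFamilyAtV (ι := ι) ↥(maximalRealSubfield (F : Type)) (F : Type) (IsCMField.complexConj (F : Type)) 3 e₁ (Matrix.diagonal dV) (complexConj_imagUnit (F : Type)) (imagUnit_ne_zero (F : Type)) (imagUnit_mul_self (F : Type)) (realDiagonal_isSymm (F : Type) dV hdV) (isUnit_det_realDiagonal (F : Type) dV hdV hdV0) (realDiagonal_map (F : Type) dV hdV).symm (le_refl 3) aOf χOf (fun t => OmegaChiSplitting.chiLocalSplittingsD ⟨HodgeCM.CMField.K F⟩ e₁ dV hdV hdV0 (toHeckeCharacter (F : Type) (ψ t)) ((isOscillatorChar_toHeckeCharacter_iff (ψ t)).mpr (hψ t)) (aOf t)) (fun t => localMu (F :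 Type) (toHeckeCharacter (F : Type) (ψ t))) (fun t v x => norm_localMu (F : Type) (toHeckeCharacter (F : Type) (ψ t)) v (isUnitary_toHeckeCharacter (F : Type) (ψ t)) x) (fun t => continuous_localMu (F : Type) (toHeckeCharacter (F : Type) (ψ t))) (fun t v x => localMu_toLocalRing_eq_one_iff (F : Type) (toHeckeCharacter (F : Type) (ψ t)) v ((isOscillatorChar_toHeckeCharacter_iff (ψ t)).mpr (hψ t)) x) v).mu i := by
  intro F dV hdV hdV0 ι ψ hψ aOf χOf v hK hE i j hiso
  exact Def411WeilCarriers.mu_eq_of_areIsomorphicRep_nonsplit_of_facts ↥(maximalRealSubfield (F : Type)) (F : Type)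
    (IsCMField.complexConj (F : Type)) (complexConj_imagUnit (F : Type)) (imagUnit_ne_zero (F : Type)) (imagUnit_mul_self (F : Type))
    (Matrix.diagonal dV) h41 h43 (realDiagonal_isSymm (F : Type) dV hdV) (isUnit_det_realDiagonal (F : Type) dV hdV hdV0)
    (realDiagonal_map (F : Type) dV hdV).symm aOf χOf
    (fun t => OmegaChiSplitting.chiLocalSplittingsD ⟨HodgeCM.CMField.K F⟩ e₁ dV hdV hdV0 (toHeckeCharacter (F : Type) (ψ t))
      ((isOscillatorChar_toHeckeCharacter_iff (ψ t)).mpr (hψ t)) (aOf t))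
    (fun t => localMu (F : Type) (toHeckeCharacter (F : Type) (ψ t)))
    (fun t v x => norm_localMu (F : Type) (toHeckeCharacter (F : Type) (ψ t)) v (isUnitary_toHeckeCharacter (F : Type) (ψ t)) x)
    (fun t => continuous_localMu (F : Type) (toHeckeCharacter (F : Type) (ψ t)))
    (fun t v x => localMu_toLocalRing_eq_one_iff (F : Type) (toHeckeCharacter (F : Type) (ψ t)) v
      ((isOscillatorChar_toHeckeCharacter_iff (ψ t)).mpr (hψ t)) x)
    v hE i j (hK i j) hiso

end Summit.HodgeConjecture.CorCM.HypD3

end
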